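import Literature.MathematicalPhysics.QuantumLattice.SchwartzTensorDensityProofs
import Literature.MathematicalPhysics.QuantumLattice.SchwartzLocalDensity
import HarnessLib

/-!
# Density of slab-ordered real product tensors in the time-ordered test functions

Trunk **T-AQFT** (topic `MathematicalPhysics/QuantumLattice`), families `constructive-qft`,
`yang-mills`; a sequel of `SchwartzTensorDensityProofs` (the box engine
`mem_closure_span_boxTensors` and the positive-wedge density
`IsPositiveTimeMulti.mem_closure_span_positiveTensorProducts_holds`) in the *ordered* wedge.

* `slabOrderedProducts d n` — the **slab-ordered real product tensors**: `n`-point test functions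
  `P = f₁ ⊗ ⋯ ⊗ fₙ` (`IsTensorOf`, factors complexified by `ofRealTest`) whose real factors `fᵢ` are
  supported in closed time slabs `lo i ≤ x⁰ ≤ hi i` that are positive (`0 < lo i`) and pairwise
  ordered (`hi i < lo j` for `i < j`). They are time-ordered (`IsTimeOrdered.of_mem_slabOrderedProducts`)
  and they are exactly the test functions on which a lattice approximation pins the Schwinger
  functions factor by factor.
* `IsTimeOrdered.mem_closure_span_slabOrderedProducts` — **ordered-wedge density**: every
  time-ordered `F ∈ 𝓢(((ℝ^d)^n), ℂ)` (`supp F ⊆ {0 < x₁⁰ < ⋯ < xₙ⁰}`, OS 1973 §2 `𝒮_<(ℝ^{dn})`) lies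
  in the closure, for the Schwartz topology, of the `ℂ`-span of `slabOrderedProducts d n`. Hence
  any property of a continuous functional of time-ordered test functions (E2, E4, the mass-gap
  clause) may be checked on slab-ordered real product tensors.

## Proof

The ordered wedge is open and `supp F` need not be compact, nor is a compact part of the wedge a
product box; three reductions bring the box engine to bear.
1. *Staggered translates.* `F_T = F(· - T w)`, `wᵢ = (i + 1) e₀`, converges to `F` as `T → 0⁺`
   (`continuous_compSubConstCLM`) and is supported in the margin set
   `{T ≤ x₁⁰, xᵢ⁰ + T ≤ xⱼ⁰ (i < j)}` (`IsTimeOrdered.margins_of_translate_ne_zero`).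
2. *Lattice partition of unity at mesh `h = T/8`.* In the coordinates `meshCoord`,
   `v ↦ (vᵢ^c / h)`, the lattice bumps `η_β` of `SchwartzPartition` sum over discrete cubes to windows
   `W_R` with `W_R F_T → F_T` (`tendsto_latticeWindow_smul`); so it suffices that every piece
   `η_β F_T` lies in the closed span.
3. *One piece* (`IsTimeOrdered.smulLeftCLM_latticeBump_translate_mem_closure`). `η_β F_T` is
   supported in the closed box `∏ [(β_{ic} - 1) h, (β_{ic} + 1) h]`; if it is nonzero the box meets
   the margin set, which forces the outer time slabs `((β_{i0} - 2) h, (β_{i0} + 2) h)` to be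
   positive and ordered (`8 h ≤ T`). The box engine `mem_closure_span_boxTensors` (Fourier series on
   the outer box, real and imaginary parts) puts the piece in the closed span of real product
   tensors with factors supported in the blocks of the outer box, which are slab-ordered.

## Sources

The statement is the `𝒮_<` analogue of `𝒮(ℝ^{4n}₊) = ⊗̂ₙ 𝒮(ℝ⁴₊)` in K. Osterwalder, R. Schrader,
*Axioms for Euclidean Green's functions*, Comm. Math. Phys. 31 (1973) 83–112, §2 pp. 86–87
[OsterwalderSchraderCMP1973]; the proof (partition of unity + Fourier series in boxes) is
textbook folklore. Not here: any statement about Schwinger functions (consumers combine the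
density with continuity themselves).

## Mathlib and Literature

Used from Mathlib: `SchwartzMap.compSubConstCLM`, `SchwartzMap.smulLeftCLM` (`smulLeftCLM_sum`,
`tsupport_smulLeftCLM_subset`), `LinearIsometryEquiv.piLpCongrLeft`, `finProdFinEquiv`,
`Submodule.topologicalClosure`. From the tree: `boxCoord`, `BoxData`, `mem_closure_span_boxTensors`
(`SchwartzTensorDensityProofs`), `latticeBump`, `latticeWindow`, `latticeCube`,
`sum_latticeCube_latticeBump`, `tendsto_latticeWindow_smul` (`SchwartzPartition`),
`hasTemperateGrowth_latticeBumpC`, `tsupport_latticeBumpC` (`SchwartzLocalDensity`),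
`continuous_compSubConstCLM` (`SchwartzTranslationCutoff`). Searched and absent at the pin: any
density statement for the ordered wedge / `IsTimeOrdered`.
-/

open scoped SchwartzMap Topology
open Filter Set

noncomputable section

namespace Literature.MathematicalPhysics.QuantumLattice

variable {d : ℕ} [NeZero d] {n : ℕ}

/-! ### Slab-ordered real product tensors -/

variable (d) in
/-- The set of **slab-ordered real product tensors** on `((ℝ^d)^n)`: the `n`-point test functions
`P = f₁ ⊗ ⋯ ⊗ fₙ` (`IsTensorOf`, complexified real factors `ofRealTest (f i)`) admitting time slabs
`lo i ≤ hi i` with `0 < lo i`, `hi i < lo j` for `i < j`, and `supp fᵢ ⊆ {lo i ≤ x⁰ ≤ hi i}`. The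
elementary tensors of OS's `𝒮_<` with separated compact time supports; a subset of
`tensorProducts n` consisting of time-ordered functions. [folklore] -/
def slabOrderedProducts (n : ℕ) : Set 𝓢((Fin n → EuclideanSpace ℝ (Fin d)), ℂ) :=
  {P | ∃ (f : Fin n → 𝓢(EuclideanSpace ℝ (Fin d), ℝ)) (lo hi : Fin n → ℝ),
    IsTensorOf P (fun i => ofRealTest (f i)) ∧ (∀ i, 0 < lo i) ∧ (∀ i, lo i ≤ hi i) ∧
      (∀ i j, i < j → hi i < lo j) ∧
      ∀ i, tsupport (f i : EuclideanSpace ℝ (Fin d) → ℝ) ⊆ {x | lo i ≤ x 0 ∧ x 0 ≤ hi i}}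

/-- Membership in `slabOrderedProducts`. [folklore] -/
theorem mem_slabOrderedProducts {P : 𝓢((Fin n → EuclideanSpace ℝ (Fin d)), ℂ)} :
    P ∈ slabOrderedProducts d n ↔ ∃ (f : Fin n → 𝓢(EuclideanSpace ℝ (Fin d), ℝ))
      (lo hi : Fin n → ℝ), IsTensorOf P (fun i => ofRealTest (f i)) ∧ (∀ i, 0 < lo i) ∧
        (∀ i, lo i ≤ hi i) ∧ (∀ i j, i < j → hi i < lo j) ∧
        ∀ i, tsupport (f i : EuclideanSpace ℝ (Fin d) → ℝ) ⊆ {x | lo i ≤ x 0 ∧ x 0 ≤ hi i} :=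
  Iff.rfl

/-- Non-vacuity: the concrete tensor product `tensorFin n (ofRealTest ∘ f)` of real factors
supported in positive ordered slabs belongs to `slabOrderedProducts d n`. [folklore] -/
theorem tensorFin_mem_slabOrderedProducts (f : Fin n → 𝓢(EuclideanSpace ℝ (Fin d), ℝ))
    {lo hi : Fin n → ℝ} (hlo : ∀ i, 0 < lo i) (hle : ∀ i, lo i ≤ hi i)
    (hord : ∀ i j, i < j → hi i < lo j)
    (hsupp : ∀ i, tsupport (f i : EuclideanSpace ℝ (Fin d) → ℝ) ⊆ {x | lo i ≤ x 0 ∧ x 0 ≤ hi i}) :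
    SchwartzMap.tensorFin n (fun i => ofRealTest (f i)) ∈ slabOrderedProducts d n :=
  ⟨f, lo, hi, isTensorOf_tensorFin _, hlo, hle, hord, hsupp⟩

/-- Slab-ordered real product tensors are tensor products of real test functions
(`tensorProducts n` of `SchwingerOSAxioms`; forget the slabs). [folklore] -/
theorem slabOrderedProducts_subset_tensorProducts :
    slabOrderedProducts d n ⊆ tensorProducts n :=
  fun _ ⟨f, _, _, hP, _⟩ => ⟨f, hP⟩

/-- **Slab-ordered real product tensors are time-ordered**: if `P = f₁ ⊗ ⋯ ⊗ fₙ` with real factors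
supported in positive, pairwise ordered time slabs then `supp P ⊆ {0 < x₁⁰ < ⋯ < xₙ⁰}`
(`IsTimeOrdered`, OS 1973 §2 `𝒮_<`). [folklore] -/
theorem IsTimeOrdered.of_mem_slabOrderedProducts {P : 𝓢((Fin n → EuclideanSpace ℝ (Fin d)), ℂ)}
    (hP : P ∈ slabOrderedProducts d n) : IsTimeOrdered P := by
  obtain ⟨f, lo, hi, hP, hlo, -, hord, hsupp⟩ := hP
  intro x hx
  have hxi : ∀ i, lo i ≤ x i 0 ∧ x i 0 ≤ hi i := fun i =>
    hsupp i (tsupport_comp_subset (g := fun t : ℝ => (t : ℂ)) Complex.ofReal_zero _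
      (hP.tsupport_subset hx i))
  refine ⟨fun i => (hlo i).trans_le (hxi i).1, fun i j hij => ?_⟩
  exact (hxi i).2.trans_lt ((hord i j hij).trans_le (hxi j).1)

/-! ### Mesh coordinates and staggered time translates -/

omit [NeZero d] in
/-- Evaluation of the block box coordinates `boxCoord` of `SchwartzTensorDensityProofs`:
`(boxCoord Λ l u v)_{ic} = Λ(v_i)_c / (u_{ic} - l_{ic})`. [folklore] -/
theorem boxCoord_apply {E : Type*} [NormedAddCommGroup E] [NormedSpace ℝ E]
    [FiniteDimensional ℝ E] {m : ℕ} (Λ : E ≃L[ℝ] EuclideanSpace ℝ (Fin m))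
    (l u : Fin n × Fin m → ℝ) (hlu : ∀ ic, l ic < u ic) (v : Fin n → E) (ic : Fin n × Fin m) :
    boxCoord Λ l u hlu v ic = (Λ (v ic.1)) ic.2 / (u ic - l ic) :=
  rfl

/-- **Mesh coordinates** at scale `h > 0` on `((ℝ^d)^n)`: the linear equivalence
`v ↦ (v_i^c / h)_{e(i,c)}` onto `ℝ^{n d}`, `e : Fin n × Fin d ≃ Fin (n d)` the standard
enumeration (`boxCoord` of the box `[0, h]^{n d}` reindexed by `finProdFinEquiv`); the lattice
partition of unity of `SchwartzPartition` in these coordinates has cells of side `h`. [folklore] -/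
def meshCoord (n d : ℕ) (h : ℝ) (hh : 0 < h) :
    (Fin n → EuclideanSpace ℝ (Fin d)) ≃L[ℝ] EuclideanSpace ℝ (Fin (n * d)) :=
  (boxCoord (ContinuousLinearEquiv.refl ℝ (EuclideanSpace ℝ (Fin d))) (fun _ => (0 : ℝ))
      (fun _ => h) (fun _ => hh)).trans
    (LinearIsometryEquiv.piLpCongrLeft 2 ℝ ℝ finProdFinEquiv).toContinuousLinearEquiv

omit [NeZero d] in
/-- Evaluation of the mesh coordinates: `(meshCoord v)_{e(i,c)} = v_i^c / h`. [folklore] -/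
theorem meshCoord_apply {h : ℝ} (hh : 0 < h) (v : Fin n → EuclideanSpace ℝ (Fin d))
    (ic : Fin n × Fin d) : meshCoord n d h hh v (finProdFinEquiv ic) = v ic.1 ic.2 / h := by
  simp only [meshCoord, ContinuousLinearEquiv.trans_apply]
  rw [LinearIsometryEquiv.coe_toContinuousLinearEquiv, LinearIsometryEquiv.piLpCongrLeft_apply]
  simp only [Equiv.piCongrLeft'_apply, Equiv.symm_apply_apply, boxCoord_apply, sub_zero]
  rfl

/-- The **staggered time shifts** `wᵢ = (i + 1) e₀`, `i < n`: translating the `i`-th argument of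
a time-ordered function by `T wᵢ` separates consecutive time supports by `T`. [folklore] -/
def staggerVec (n d : ℕ) [NeZero d] : Fin n → EuclideanSpace ℝ (Fin d) :=
  fun i => EuclideanSpace.single 0 (((i : ℕ) : ℝ) + 1)

/-- Time coordinates of `v - T w`: `(v - T w)_i⁰ = v_i⁰ - T (i + 1)`. [folklore] -/
theorem sub_smul_staggerVec_apply_zero (v : Fin n → EuclideanSpace ℝ (Fin d)) (T : ℝ)
    (i : Fin n) : (v - T • staggerVec n d) i 0 = v i 0 - T * (((i : ℕ) : ℝ) + 1) := by
  simp [staggerVec]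

/-- **Margins of the staggered translate.** If `F` is time-ordered, `T ≥ 0` and
`F(v - T w) ≠ 0`, then `T ≤ v_i⁰` for all `i` and `v_i⁰ + T ≤ v_j⁰` for `i < j`
(from `0 < v_i⁰ - T(i+1)` and the strict monotonicity of `i ↦ v_i⁰ - T(i+1)`). [folklore] -/
theorem IsTimeOrdered.margins_of_translate_ne_zero
    {F : 𝓢((Fin n → EuclideanSpace ℝ (Fin d)), ℂ)} (hF : IsTimeOrdered F) {T : ℝ} (hT : 0 ≤ T)
    {v : Fin n → EuclideanSpace ℝ (Fin d)}
    (hv : SchwartzMap.compSubConstCLM ℂ (T • staggerVec n d) F v ≠ 0) :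
    (∀ i, T ≤ v i 0) ∧ ∀ i j, i < j → v i 0 + T ≤ v j 0 := by
  rw [SchwartzMap.compSubConstCLM_apply] at hv
  obtain ⟨hpos, hmono⟩ := hF (subset_tsupport _ hv)
  refine ⟨fun i => ?_, fun i j hij => ?_⟩
  · have h1 := hpos i
    rw [sub_smul_staggerVec_apply_zero] at h1
    have hi : (0 : ℝ) ≤ ((i : ℕ) : ℝ) := Nat.cast_nonneg _
    nlinarith [mul_nonneg hT hi]
  · have h1 := hmono hij
    simp only [sub_smul_staggerVec_apply_zero] at h1
    have hij' : ((i : ℕ) : ℝ) + 1 ≤ ((j : ℕ) : ℝ) := by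
      exact_mod_cast Nat.succ_le_of_lt (Fin.lt_def.1 hij)
    nlinarith [mul_le_mul_of_nonneg_left hij' hT]

/-- **Staggered translates converge**: `F(· - T w) → F` in `𝓢` as `T → 0⁺` (strong continuity of
translations, `continuous_compSubConstCLM`). [folklore] -/
theorem tendsto_compSubConstCLM_staggerVec (F : 𝓢((Fin n → EuclideanSpace ℝ (Fin d)), ℂ)) :
    Tendsto (fun T : ℝ => SchwartzMap.compSubConstCLM ℂ (T • staggerVec n d) F)
      (𝓝[>] 0) (𝓝 F) := by
  have hc : Continuous fun T : ℝ => SchwartzMap.compSubConstCLM ℂ (T • staggerVec n d) F :=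
    (continuous_compSubConstCLM ℂ F).comp (continuous_id.smul continuous_const)
  have h := hc.tendsto 0
  simp only [zero_smul, SchwartzMap.compSubConstCLM_zero, ContinuousLinearMap.coe_id', id] at h
  exact h.mono_left nhdsWithin_le_nhds

/-! ### The pieces of the partition and the density theorem -/

/-- **One piece of the lattice partition of a staggered translate lies in the closed span.** For a
time-ordered `F`, `0 < h`, `8 h ≤ T` and `β ∈ ℤ^{n d}`, the piece `η_β · F(· - T w)` (`η_β` the
lattice bump of `SchwartzPartition` in the mesh coordinates at scale `h`) belongs to the closure of
the span of `slabOrderedProducts d n`: it is supported in the closed box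
`∏ [(β_{ic} - 1) h, (β_{ic} + 1) h]`, and unless it vanishes this box meets the margin set of the
translate, whence the outer time slabs `((β_{i0} - 2) h, (β_{i0} + 2) h)` are positive and ordered;
conclude by the box engine `mem_closure_span_boxTensors`. [folklore] -/
theorem IsTimeOrdered.smulLeftCLM_latticeBump_translate_mem_closure
    {F : 𝓢((Fin n → EuclideanSpace ℝ (Fin d)), ℂ)} (hF : IsTimeOrdered F) {T h : ℝ} (hh : 0 < h)
    (hhT : 8 * h ≤ T) (β : Fin (n * d) → ℤ) :
    SchwartzMap.smulLeftCLM ℂ (fun y => ((latticeBump (meshCoord n d h hh) β y : ℝ) : ℂ))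
        (SchwartzMap.compSubConstCLM ℂ (T • staggerVec n d) F) ∈
      closure (Submodule.span ℂ (slabOrderedProducts d n) :
        Set 𝓢((Fin n → EuclideanSpace ℝ (Fin d)), ℂ)) := by
  -- adapted from `apply_eq_integral_of_localDensity_of_hasCompactSupport` (the pieces `η_β F`) and
  -- `IsPositiveTimeMulti.mem_closure_span_positiveTensorProducts_holds` (the boxes)
  set FT := SchwartzMap.compSubConstCLM ℂ (T • staggerVec n d) F
  set G := SchwartzMap.smulLeftCLM ℂ (fun y => ((latticeBump (meshCoord n d h hh) β y : ℝ) : ℂ)) FT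
    with hG
  have hT : 0 ≤ T := by linarith
  -- the box of `β` in the coordinates `v_i^c`
  obtain ⟨b, hb⟩ : ∃ b : Fin n × Fin d → ℝ, ∀ ic, b ic = ((β (finProdFinEquiv ic) : ℤ) : ℝ) :=
    ⟨_, fun _ => rfl⟩
  have hbox : ∀ v ∈ tsupport (G : (Fin n → EuclideanSpace ℝ (Fin d)) → ℂ), ∀ ic : Fin n × Fin d,
      b ic * h - h ≤ v ic.1 ic.2 ∧ v ic.1 ic.2 ≤ b ic * h + h := by
    intro v hv ic
    have h1 := (SchwartzMap.tsupport_smulLeftCLM_subset (F := ℂ) _ FT hv).2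
    rw [tsupport_latticeBumpC (meshCoord n d h hh) β] at h1
    have h2 := tsupport_latticeBump_subset (meshCoord n d h hh) β h1 (finProdFinEquiv ic)
    rw [meshCoord_apply, mem_Icc, ← hb ic] at h2
    constructor
    · have h3 : b ic - 1 ≤ v ic.1 ic.2 / h := by linarith [h2.1]
      rw [le_div_iff₀ hh] at h3
      linarith
    · have h3 : v ic.1 ic.2 / h ≤ b ic + 1 := by linarith [h2.2]
      rw [div_le_iff₀ hh] at h3
      linarith
  -- the zero piece
  by_cases hG0 : G = 0
  · rw [hG0]
    exact subset_closure (Submodule.zero_mem _)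
  -- otherwise a point of the support lies in the box and in the margin set
  obtain ⟨v, hv⟩ : ∃ v, G v ≠ 0 := by
    by_contra hcon
    push Not at hcon
    exact hG0 (SchwartzMap.ext hcon)
  have hvbox := hbox v (subset_tsupport _ hv)
  have hFTv : FT v ≠ 0 := by
    rw [hG, SchwartzMap.smulLeftCLM_apply_apply
      (hasTemperateGrowth_latticeBumpC (meshCoord n d h hh) β)] at hv
    exact right_ne_zero_of_smul hv
  obtain ⟨hvpos, hvord⟩ := hF.margins_of_translate_ne_zero hT hFTv
  have hlo : ∀ i, 0 < b (i, 0) * h - 2 * h := fun i => by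
    have h1 := hvpos i
    have h2 := (hvbox (i, 0)).2
    dsimp only at h2
    linarith
  have hord : ∀ i j, i < j → b (i, 0) * h + 2 * h < b (j, 0) * h - 2 * h := fun i j hij => by
    have h1 := hvord i j hij
    have h2 := (hvbox (i, 0)).1
    have h3 := (hvbox (j, 0)).2
    dsimp only at h2 h3
    linarith
  -- the nested boxes and the box engine
  let B : BoxData n d :=
    { l := fun ic => b ic * h - 2 * h, u := fun ic => b ic * h + 2 * h
      l' := fun ic => b ic * h - h, u' := fun ic => b ic * h + h
      hl := fun ic => by linarith, hl' := fun ic => by linarith, hu := fun ic => by linarith }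
  let Λ₀ : EuclideanSpace ℝ (Fin d) ≃L[ℝ] EuclideanSpace ℝ (Fin d) := ContinuousLinearEquiv.refl ℝ _
  have hF' : tsupport (G : (Fin n → EuclideanSpace ℝ (Fin d)) → ℂ) ⊆
      {v | ∀ ic : Fin n × Fin d, (Λ₀ (v ic.1)) ic.2 ∈ Icc (B.l' ic) (B.u' ic)} :=
    fun v hv ic => hbox v hv ic
  refine closure_mono (Submodule.span_mono ?_) (mem_closure_span_boxTensors Λ₀ B G hF')
  rintro P ⟨g, hg, hP⟩
  refine ⟨g, fun i => b (i, 0) * h - 2 * h, fun i => b (i, 0) * h + 2 * h, hP, hlo,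
    fun i => by linarith, hord, fun i x hx => ?_⟩
  have h1 := hg i hx 0
  exact ⟨h1.1.le, h1.2.le⟩

/-- **Ordered-wedge density (slab-ordered real product tensors are total among the time-ordered
test functions).** Every time-ordered `n`-point test function `F` on `((ℝ^d)^n)`
(`supp F ⊆ {0 < x₁⁰ < ⋯ < xₙ⁰}`, OS's `𝒮_<(ℝ^{dn})`) lies in the closure, for the Schwartz
topology, of the `ℂ`-span of the slab-ordered real product tensors `f₁ ⊗ ⋯ ⊗ fₙ`
(`slabOrderedProducts d n`). The `𝒮_<` analogue of `𝒮(ℝ^{4n}₊) = ⊗̂ₙ 𝒮(ℝ⁴₊)` (OS 1973 §2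
pp. 86–87). Proof: staggered translates `F(· - T w) → F` (`T → 0⁺`) with margins `T`; lattice
partition of unity at mesh `T/8` (`tendsto_latticeWindow_smul`); each piece is in the closed span
(`IsTimeOrdered.smulLeftCLM_latticeBump_translate_mem_closure`). [cite: OsterwalderSchraderCMP1973, §2 pp. 86–87] -/
theorem IsTimeOrdered.mem_closure_span_slabOrderedProducts
    {F : 𝓢((Fin n → EuclideanSpace ℝ (Fin d)), ℂ)} (hF : IsTimeOrdered F) :
    F ∈ closure (Submodule.span ℂ (slabOrderedProducts d n) :
      Set 𝓢((Fin n → EuclideanSpace ℝ (Fin d)), ℂ)) := by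
  have hC : IsClosed (closure (Submodule.span ℂ (slabOrderedProducts d n) :
      Set 𝓢((Fin n → EuclideanSpace ℝ (Fin d)), ℂ))) := isClosed_closure
  -- step 1: staggered forward time translates `F(· - T w) → F`, `T → 0⁺`
  refine hC.mem_of_tendsto (tendsto_compSubConstCLM_staggerVec F)
    (eventually_nhdsWithin_of_forall fun T hT => ?_)
  have hT : (0 : ℝ) < T := hT
  set FT := SchwartzMap.compSubConstCLM ℂ (T • staggerVec n d) F
  -- step 2: the lattice partition of unity at mesh `T / 8`, `W_R · FT → FT`
  have hh : (0 : ℝ) < T / 8 := by positivity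
  set Λ := meshCoord n d (T / 8) hh
  -- adapted from `tendsto_sum_eta` (`SchwartzNuclearExpansion`): `∑_β η_β · FT = W_R · FT → FT`
  have hlim : Tendsto (fun R : ℕ => ∑ β ∈ latticeCube (n * d) R,
      SchwartzMap.smulLeftCLM ℂ (fun y => ((latticeBump Λ β y : ℝ) : ℂ)) FT) atTop (𝓝 FT) := by
    have hsum : ∀ R : ℕ, ∑ β ∈ latticeCube (n * d) R,
        SchwartzMap.smulLeftCLM ℂ (fun y => ((latticeBump Λ β y : ℝ) : ℂ)) FT =
          SchwartzMap.smulLeftCLM ℂ (fun y => ((latticeWindow Λ R y : ℝ) : ℂ)) FT := by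
      intro R
      have hW : (fun y => ((latticeWindow Λ R y : ℝ) : ℂ)) =
          fun y => ∑ β ∈ latticeCube (n * d) R, ((latticeBump Λ β y : ℝ) : ℂ) := by
        funext y
        rw [← sum_latticeCube_latticeBump Λ R y, Complex.ofReal_sum]
      rw [hW, SchwartzMap.smulLeftCLM_sum fun β _ => hasTemperateGrowth_latticeBumpC Λ β,
        FunLike.coe_sum, Finset.sum_apply]
    simp_rw [hsum]
    exact tendsto_latticeWindow_smul Λ ℂ FT
  refine hC.mem_of_tendsto hlim (Eventually.of_forall fun R => ?_)
  -- step 3: every piece lies in the closed span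
  exact (Submodule.span ℂ (slabOrderedProducts d n)).topologicalClosure.sum_mem fun β _ =>
    hF.smulLeftCLM_latticeBump_translate_mem_closure hh (by linarith) β

end Literature.MathematicalPhysics.QuantumLattice
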